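import Summits.Ventures.PercRepro.S2SharpTopXQICTQ5

/-!
# PercRepro — S2: THE TOP COUNT AT LEVEL `5` WITH THE `5`-ELEMENT TERM A PARAMETER — THE COINDEPENDENT SPLIT (p7, gen 10; sub-claim S2; the `p = 16` row)

The top sets `{A : ρ(A) = p, ρ(E ∖ A) = 5}` are, through `A ↦ E ∖ A`, the COINDEPENDENT rank-`5` sets of `≤ d` elements
(`topCount_le_ncard_compl_spanning`: the kit's `Matroid.topCount_le_ncard_compl` keeping the spanning condition
`ρ(E ∖ B) = ρ(E)`). Splitting off the `5`-element ones,
`#Sc + #{independent 5-sets} ≤ #{coindependent 5-sets} + #{rank-5 sets of ≤ D elements}` (`ncard_spanning_level_add_le_split`),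
so that the partition count `S2.ncard_eRk_eq_ncard_le_le_sets_indep_quart` gives the `(U)`-side of the level-`5` cell with the
`5`-element term a PARAMETER `V ≥ #{B : |B| = 5, ρ(E ∖ B) = ρ(E)}` in place of the triangle-corrected `C(n, 5) − s₃·C(n − 3, 2) + C(s₃, 2)`:
**`topCount_le_payment_xqictq5`** — `S2SharpTopXQICTQ5`'s `topCount_le_sharp_xqictq5` word for word on the `6`-set side
(`σ_m·(s3b·C(n − 3, 3) + s4b·C(n − 4, 2) + s5b·(n − 5) + C(d + 5, 6)) + (σ_g − σ_m)·C(F_max, 6)`, quart weights), the `5`-set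
side `V`. With `V` the nullity-payment count of `S2CoindepCount` (`S2.ncard_spanning_compl_le_of_nullity` at `m = 5`) this is the
concentrated half of the `(16, 7)` dichotomy (S2PaymentSixteenSeven). Axioms: standard.
-/

open scoped Matroid

namespace PercRepro

namespace S2

open Set

variable {α : Type} {M : Matroid α}

/-- **The top count is bounded by the COINDEPENDENT rank-`q` sets of `≤ d` elements**: `A ↦ E ∖ A` is an injection of
the top sets `{A : ρ(A) = p, ρ(E ∖ A) = q}` into `{B ⊆ E : ρ(B) = q, |B| ≤ d, ρ(E ∖ B) = ρ(E)}` (the kit's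
`Matroid.topCount_le_ncard_compl`, keeping the spanning condition on the complement). -/
theorem topCount_le_ncard_compl_spanning [M.Finite] {p d : ℕ} (hR : M.eRank = (p : ℕ∞))
    (hd : M.E.encard = M.eRank + d) (q : ℕ) :
    Matroid.topCount M p q ≤
      {B : Set α | B ⊆ M.E ∧ M.eRk B = q ∧ B.ncard ≤ d ∧ M.eRk (M.E \ B) = M.eRank}.ncard := by
  classical
  have hν : M✶.eRank = (d : ℕ∞) := by
    have h := _root_.Matroid.eRank_add_eRank_dual M
    rw [hd] at h
    exact WithTop.add_left_cancel (Matroid.eRank_ne_top_of_finite M) h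
  unfold Matroid.topCount
  have hmaps : ∀ A ∈ {A : Set α | A ⊆ M.E ∧ M.eRk A = (p : ℕ∞) ∧ M.eRk (M.E \ A) = (q : ℕ∞)},
      M.E \ A ∈ {B : Set α | B ⊆ M.E ∧ M.eRk B = q ∧ B.ncard ≤ d ∧ M.eRk (M.E \ B) = M.eRank} := by
    intro A hA
    refine ⟨sdiff_subset, hA.2.2, ?_, ?_⟩
    · have hsp : M.Spanning A := by
        rw [_root_.Matroid.spanning_iff_eRk_le']
        exact ⟨by rw [hR, hA.2.1], hA.1⟩
      have hco : M.Coindep (M.E \ A) := by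
        rw [_root_.Matroid.coindep_iff_compl_spanning sdiff_subset, sdiff_sdiff_cancel_left hA.1]
        exact hsp
      have hind : M✶.Indep (M.E \ A) := _root_.Matroid.coindep_def.1 hco
      have h := hind.encard_le_eRank
      rw [hν, ← (M.ground_finite.sdiff).cast_ncard_eq] at h
      exact_mod_cast h
    · rw [sdiff_sdiff_cancel_left hA.1, hA.2.1, hR]
  have hinj : InjOn (fun A => M.E \ A)
      {A : Set α | A ⊆ M.E ∧ M.eRk A = (p : ℕ∞) ∧ M.eRk (M.E \ A) = (q : ℕ∞)} := by
    intro A hA A' hA' h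
    simp only at h
    rw [← sdiff_sdiff_cancel_left hA.1, h, sdiff_sdiff_cancel_left hA'.1]
  exact ncard_le_ncard_of_injOn (fun A => M.E \ A) hmaps hinj
    (M.ground_finite.finite_subsets.subset (fun B hB => hB.1))

/-- **The `q`-element split of the coindependent level sets**: for `q ≤ D`,
`#{B : ρ(B) = q, |B| ≤ D, ρ(E ∖ B) = ρ(E)} + #{B : |B| = q, ρ(B) = q} ≤ #{B : |B| = q, ρ(E ∖ B) = ρ(E)} + #{B : ρ(B) = q, |B| ≤ D}`
(the coindependent sets of `q` elements go to the first summand on the right, the others into the level count minus its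
independent `q`-sets). -/
theorem ncard_spanning_level_add_le_split [M.Finite] (q D : ℕ) (hqD : q ≤ D) :
    {B : Set α | B ⊆ M.E ∧ M.eRk B = q ∧ B.ncard ≤ D ∧ M.eRk (M.E \ B) = M.eRank}.ncard +
      {B : Set α | B ⊆ M.E ∧ B.ncard = q ∧ M.eRk B = q}.ncard ≤
    {B : Set α | B ⊆ M.E ∧ B.ncard = q ∧ M.eRk (M.E \ B) = M.eRank}.ncard +
      {B : Set α | B ⊆ M.E ∧ M.eRk B = q ∧ B.ncard ≤ D}.ncard := by
  classical
  set Sc : Set (Set α) :=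
    {B : Set α | B ⊆ M.E ∧ M.eRk B = q ∧ B.ncard ≤ D ∧ M.eRk (M.E \ B) = M.eRank} with hSc
  set Sq : Set (Set α) := {B : Set α | B ⊆ M.E ∧ B.ncard = q ∧ M.eRk B = q} with hSq
  set Sqc : Set (Set α) := {B : Set α | B ⊆ M.E ∧ B.ncard = q ∧ M.eRk (M.E \ B) = M.eRank} with hSqc
  set S : Set (Set α) := {B : Set α | B ⊆ M.E ∧ M.eRk B = q ∧ B.ncard ≤ D} with hS
  have hfin : ∀ T : Set (Set α), T ⊆ {B : Set α | B ⊆ M.E} → T.Finite :=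
    fun T hT => M.ground_finite.finite_subsets.subset hT
  have hScfin : Sc.Finite := hfin Sc (fun B hB => hB.1)
  have hSfin : S.Finite := hfin S (fun B hB => hB.1)
  have hSqcfin : Sqc.Finite := hfin Sqc (fun B hB => hB.1)
  -- `Sq ⊆ S` (`q ≤ D`), `Sc ∩ Sq ⊆ Sqc`, `Sc \ Sq ⊆ S \ Sq`
  have hSqS : Sq ⊆ S := fun B hB => ⟨hB.1, hB.2.2, by rw [hB.2.1]; exact hqD⟩
  have h1 : Sc ∩ Sq ⊆ Sqc := fun B hB => ⟨hB.1.1, hB.2.2.1, hB.1.2.2.2⟩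
  have h2 : Sc \ Sq ⊆ S \ Sq := fun B hB => ⟨⟨hB.1.1, hB.1.2.1, hB.1.2.2.1⟩, hB.2⟩
  have e1 : (Sc ∩ Sq).ncard + (Sc \ Sq).ncard = Sc.ncard :=
    ncard_inter_add_ncard_sdiff_eq_ncard Sc Sq hScfin
  have e2 : (S \ Sq).ncard + Sq.ncard = S.ncard := ncard_sdiff_add_ncard_of_subset hSqS hSfin
  have i1 : (Sc ∩ Sq).ncard ≤ Sqc.ncard := ncard_le_ncard h1 hSqcfin
  have i2 : (Sc \ Sq).ncard ≤ (S \ Sq).ncard := ncard_le_ncard h2 hSfin.sdiff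
  omega

end S2

namespace ThmN

open Set

variable {α : Type}

/-- **The top count at level `5` with the `5`-element term a parameter** (the `(U)`-side of the level-`5` cell with the
coindependent `5`-sets counted separately): on the `e`-free core of rank `p` and corank `d ≥ 6`,
`#U(p, 5) ≤ V + σ_m·(s3b·C(n − 3, 3) + s4b·C(n − 4, 2) + s5b·(n − 5) + C(d + 5, 6)) + (σ_g − σ_m)·C(F_max, 6)`
for any `V ≥ #{B ⊆ E : |B| = 5, ρ(E ∖ B) = ρ(E)}`, `s3b ≥ s₃`, `s4b ≥ s₄`, `s5b ≥ s₅`, with the quart weights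
(`topCount_le_sharp_xqictq5` with the triangle-corrected `C(n, 5) − s3b·C(n − 3, 2) + C(s3b, 2)` replaced by `V`). -/
theorem topCount_le_payment_xqictq5 (M : Matroid α) [M.Finite] (p d : ℕ) (hd6 : 6 ≤ d)
    (hR : M.eRank = (p : ℕ∞)) (hn : M.E.ncard = p + d)
    (hfree : ∀ e ∈ M.E, ∃ A ⊆ M.E \ {e}, e ∉ M.closure A ∧ e ∉ M.closure ((M.E \ {e}) \ A))
    (s3b s4b s5b : ℕ) (hs3 : {C : Set α | M.IsCircuit C ∧ C.ncard = 3}.ncard ≤ s3b)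
    (hs4 : {C : Set α | M.IsCircuit C ∧ C.ncard = 4}.ncard ≤ s4b)
    (hs5 : {C : Set α | M.IsCircuit C ∧ C.ncard = 5}.ncard ≤ s5b)
    (V : ℕ) (hV : {B : Set α | B ⊆ M.E ∧ B.ncard = 5 ∧ M.eRk (M.E \ B) = M.eRank}.ncard ≤ V) :
    (Matroid.topCount M p 5 : ℚ) ≤ (V : ℚ) +
      (∑ j ∈ Finset.range (d - 5), (Nat.choose (min 13 ((d + 6) / 2 + 1 - 2)) j : ℚ) / (((j + 1) + 3 * (j + 1).choose 2 + 3 * (j + 1).choose 3 + 2 * (j + 1).choose 4 : ℕ) : ℚ)) *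
        ((s3b * (p + d - 3).choose 3 + s4b * (p + d - 4).choose 2 +
          s5b * (p + d - 5) + (d + 5).choose 6 : ℕ) : ℚ) +
      ((∑ j ∈ Finset.range (d - 5), (Nat.choose (min 19 (5 + d) - 6) j : ℚ) / (((j + 1) + 3 * (j + 1).choose 2 + 3 * (j + 1).choose 3 + 2 * (j + 1).choose 4 : ℕ) : ℚ)) -
        (∑ j ∈ Finset.range (d - 5), (Nat.choose (min 13 ((d + 6) / 2 + 1 - 2)) j : ℚ) / (((j + 1) + 3 * (j + 1).choose 2 + 3 * (j + 1).choose 3 + 2 * (j + 1).choose 4 : ℕ) : ℚ))) *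
        ((min 19 (5 + d)).choose 6 : ℚ) := by
  classical
  have hL0 : ∀ e ∈ M.E, ¬ M.IsLoop e := not_isLoop_of_free M hfree
  have hs : ∀ e ∈ M.E, ∀ f ∈ M.E, e ≠ f → M.eRk {e, f} = 2 := by
    intro e he f hf hef
    have h2 : (2 : ℕ∞) ≤ M.eRk {e, f} :=
      two_le_eRk_of_two_le_ncard_of_free M hfree (pair_subset he hf) (by rw [ncard_pair hef])
    have h3 : M.eRk {e, f} ≤ 2 := by
      have := M.eRk_le_encard {e, f}
      rwa [encard_pair hef] at this
    exact le_antisymm h3 h2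
  have hcirc : ∀ C, M.IsCircuit C → 3 ≤ C.encard := three_le_encard_of_circuit M hL0 hs
  have hd : M.E.encard = M.eRank + d := by
    rw [hR, ← M.ground_finite.cast_ncard_eq, hn]
    push_cast
    ring
  -- the capped flat bounds: rank-`≤ 5` sets have `≤ min 19 (5 + d)` points, rank-`≤ 4` sets `≤ min 10 (4 + d)`
  have hflat : ∀ X ⊆ M.E, M.eRk X ≤ 5 → X.ncard ≤ min 19 (5 + d) := fun X hX hr =>
    le_min (ncard_le_nineteen_of_eRk_le_five_of_free M hfree hX hr)
      (ncard_le_add_of_eRk_le_of_encard_eq M hd hX hr)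
  have hflat' : ∀ X ⊆ M.E, M.eRk X ≤ ((5 - 1 : ℕ) : ℕ∞) → X.ncard ≤ min 10 (4 + d) := fun X hX hr =>
    le_min (ncard_le_ten_of_eRk_le_four_of_free M hfree hX (by simpa using hr))
      (ncard_le_add_of_eRk_le_of_encard_eq M hd hX (by simpa using hr))
  -- the circuit counts: Lemma T, Lemma T4, and the nullity bounds
  have hC1 : ∀ L ⊆ M.E, M.eRk L = 2 → L.ncard ≤ 3 :=
    fun L hL hr => ncard_le_three_of_eRk_two M hs hfree hL hr
  have hC2 : ∀ P ⊆ M.E, M.eRk P ≤ 3 → P.ncard ≤ 6 :=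
    fun P hP hr => ncard_le_six_of_eRk_le_three_of_free M hfree hP hr
  have hs6 : {C | M.IsCircuit C ∧ C.ncard = 6}.ncard ≤ (d + 5).choose 6 :=
    Matroid.ncard_circuits_le_choose_of_encard M hd 5
  -- (U): the square-multiplicity count in the PARTITION form, in `ℚ`, then the circuit bounds
  set ν₁ : ℕ := (d + 6) / 2 + 1 with hν₁
  have hU0 := S2.ncard_eRk_eq_ncard_le_le_sets_indep_quart M 5 (min 19 (5 + d)) (min 10 (4 + d)) ν₁ 6 d (by norm_num)
    hcirc hC1 hC2 hflat hflat' (hinter_five M hfree) hd (by omega) (by omega) (by omega)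
  have hU1 := S2.topCount_le_ncard_compl_spanning (M := M) hR hd 5
  have hsplit := S2.ncard_spanning_level_add_le_split (M := M) 5 d (by omega)
  have hm1 : min (min 19 (5 + d) - 6) (ν₁ - 2) = min 13 ((d + 6) / 2 + 1 - 2) := by omega
  have hm3 : min (min 19 (5 + d)) (5 + d) = min 19 (5 + d) := by omega
  simp only [show (5 : ℕ) + 1 = 6 from rfl] at hU0
  rw [hn, sum_Icc_three_six_q, hm1, hm3, show d - 6 + 1 = d - 5 by omega] at hU0
  simp only [show (6 : ℕ) - 3 = 3 from rfl, show (6 : ℕ) - 4 = 2 from rfl,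
    show (6 : ℕ) - 5 = 1 from rfl, show (6 : ℕ) - 6 = 0 from rfl, Nat.choose_one_right,
    Nat.choose_zero_right] at hU0
  set σm : ℚ := ∑ j ∈ Finset.range (d - 5), (Nat.choose (min 13 ((d + 6) / 2 + 1 - 2)) j : ℚ) / (((j + 1) + 3 * (j + 1).choose 2 + 3 * (j + 1).choose 3 + 2 * (j + 1).choose 4 : ℕ) : ℚ) with hσmdef
  -- the `3`-, `4`-, `5`-, `6`-circuit terms against the caps
  have hsm : {C | M.IsCircuit C ∧ C.ncard = 3}.ncard * (p + d - 3).choose 3 +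
      {C | M.IsCircuit C ∧ C.ncard = 4}.ncard * (p + d - 4).choose 2 +
      {C | M.IsCircuit C ∧ C.ncard = 5}.ncard * (p + d - 5) + {C | M.IsCircuit C ∧ C.ncard = 6}.ncard * 1 ≤
      s3b * (p + d - 3).choose 3 + s4b * (p + d - 4).choose 2 + s5b * (p + d - 5) + (d + 5).choose 6 := by
    have := hs6
    gcongr
    omega
  have hsmq : (({C | M.IsCircuit C ∧ C.ncard = 3}.ncard : ℚ) * ((p + d - 3).choose 3 : ℚ) +
      ({C | M.IsCircuit C ∧ C.ncard = 4}.ncard : ℚ) * ((p + d - 4).choose 2 : ℚ) +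
      ({C | M.IsCircuit C ∧ C.ncard = 5}.ncard : ℚ) * ((p + d - 5 : ℕ) : ℚ) +
      ({C | M.IsCircuit C ∧ C.ncard = 6}.ncard : ℚ) * ((1 : ℕ) : ℚ)) ≤
      ((s3b * (p + d - 3).choose 3 + s4b * (p + d - 4).choose 2 + s5b * (p + d - 5) + (d + 5).choose 6 : ℕ) : ℚ) := by
    exact_mod_cast hsm
  have hσm0 : (0 : ℚ) ≤ σm := Finset.sum_nonneg (fun j _ => by positivity)
  have hU1q : (Matroid.topCount M p 5 : ℚ) ≤
      ({B : Set α | B ⊆ M.E ∧ M.eRk B = 5 ∧ B.ncard ≤ d ∧ M.eRk (M.E \ B) = M.eRank}.ncard : ℚ) := by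
    exact_mod_cast hU1
  have hsplitq : ({B : Set α | B ⊆ M.E ∧ M.eRk B = 5 ∧ B.ncard ≤ d ∧ M.eRk (M.E \ B) = M.eRank}.ncard : ℚ) +
      ({B : Set α | B ⊆ M.E ∧ B.ncard = 5 ∧ M.eRk B = 5}.ncard : ℚ) ≤
      ({B : Set α | B ⊆ M.E ∧ B.ncard = 5 ∧ M.eRk (M.E \ B) = M.eRank}.ncard : ℚ) +
      ({B : Set α | B ⊆ M.E ∧ M.eRk B = 5 ∧ B.ncard ≤ d}.ncard : ℚ) := by
    exact_mod_cast hsplit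
  have hVq : ({B : Set α | B ⊆ M.E ∧ B.ncard = 5 ∧ M.eRk (M.E \ B) = M.eRank}.ncard : ℚ) ≤ (V : ℚ) := by
    exact_mod_cast hV
  have e1 := mul_le_mul_of_nonneg_left hsmq hσm0
  push_cast at e1 hU0 ⊢
  linarith [hU1q, hsplitq, hVq, hU0, e1]

end ThmN

end PercRepro
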